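import Mathlib
import Summits.KontsevichZagierPeriods.Zeta5Search.TypeSpaceLawOriginTwoSided
import Summits.KontsevichZagierPeriods.Zeta5Search.TypeSpaceLawOriginTransfer
import HarnessLib

/-!
# ζ(5) search — the type-space law, ORIGIN regime, HOLDS: `ResidueLaw.TypeSpaceLawOrigin` (`v_p(Cas_j(b)) ≥ 5 − 2M = casLB + 2`)

HONEST FRAMING: systematic search; no irrationality claim unless certified.

Cell `pub-zeta5`, prover seat p3 (gen 2).  REPORT-gen2-g11 §4 THEOREM W (O) as stated in the tree (`ResidueLaw.TypeSpaceLawOrigin`,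
parallelism of the point differences assumed for `b` ONLY): the two-sided theorem `SecondOrder.typeSpaceLawOrigin_twoSided`
(`TypeSpaceLawOriginTwoSided`) with the parallelism hypothesis for `b + e_j` supplied by the exact transport `SecondOrder.HD_shift`
(`TypeSpaceLawOriginTransfer`: through a hit deep orbit the doubled point moves by `(L − 2ℓ₀)·(σ_z − σ_z̄) ∥ u`).
This discharges the `@[conjecture]` node `ResidueLaw.TypeSpaceLawOrigin` by name.  `p`-adic valuations of rational numbers; nothing here
bears on irrationality.
-/

namespace Summit.KontsevichZagierPeriods.Zeta5Search.ResidueLaw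

open Summit.KontsevichZagierPeriods.Zeta5Search.SecondOrder (typeSpaceLawOrigin_twoSided HD_shift)

/-- **THE TYPE-SPACE LAW, ORIGIN REGIME, HOLDS** (tree statement `ResidueLaw.TypeSpaceLawOrigin`, by name): window prime `5 ≤ p ≤ b₀ < p² − 2`,
`M ≥ 6` even, `u ≢ 0 (mod p)`, pole classes `E ≥ −M`, classes of exponent `−M` centre-free with exact first-order orbit vector `∥ u`, DEG,
and the differences of the doubled orbit points of `b` parallel to `u` mod `p` ⟹ `v_p(Cas_j(b)) ≥ 5 − 2M`.  Proof: the two-sided theorem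
`typeSpaceLawOrigin_twoSided` with the parallelism for `b + e_j` supplied by `HD_shift`. -/
theorem typeSpaceLawOrigin_holds : TypeSpaceLawOrigin := by
  intro b p j M u hb hb' hj1 hj7 hprime hp5 hpb hwin hM hMe hu G1 G3o hdeg HD hcas
  haveI : Fact p.Prime := ⟨hprime⟩
  exact typeSpaceLawOrigin_twoSided b hb hb' hj1 hj7 hp5 hpb hwin hM hMe u hu G1 G3o hdeg HD
    (HD_shift b hb hb' hj1 hj7 hpb u G1 G3o HD) hcas

end Summit.KontsevichZagierPeriods.Zeta5Search.ResidueLaw
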